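import Summits.BirchSwinnertonDyer.BirchSwinnertonDyer.Theorems.PrintX6DescentCertificateRoad
import Summits.BirchSwinnertonDyer.BirchSwinnertonDyer.Theorems.SignedLowerHalvesKobayashiLowerHalfSemistableScopeThree
import Summits.BirchSwinnertonDyer.BirchSwinnertonDyer.Theorems.SignedLowerHalvesKobayashiLowerHalfSemistableScopeThreeB
import Summits.BirchSwinnertonDyer.BirchSwinnertonDyer.Theorems.SignedLowerHalvesKobayashiLowerHalfSemistableScopeThreeC
import Summits.BirchSwinnertonDyer.BirchSwinnertonDyer.Theorems.SignedLowerHalvesKobayashiLowerHalfSemistableScopeThreeD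
import Summits.BirchSwinnertonDyer.BirchSwinnertonDyer.Theorems.Rank1ResidualX11RankOneMinimality
import Summits.BirchSwinnertonDyer.Rank1Residual.X11b.ChaPairsMinimality
import HarnessLib

/-!
# Print tier P-X6 (cell `bsd-print-x6`, seat p4): the certificate road DISPLAYED on the twelve non-unit A6 cells
# at `p = 3` — `BSD(E,3)` per pair from THREE published facts (Wuthrich 2014 Prop. 21, GZK, modularity) + ONE exact
# two-engine `3`-descent line `#Sel^(3)(E/ℚ) = 9`; NO Cassels–Tate (bsd.S18 leaves the trust base)

PARTITION currency (D-0054): board A6 (X6 ∧ r_an = 0) × the 12 cells at `p = 3` of `pub/pub-bsdres/PARTITION-SCOREBOARD.md`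
(`2534e1`, `4343b1`, `4963c1`, `5561a1`, `8710b1`, `12034a1`, `15755a1`, `16982a1`, `17917b1`, `19142a1`, `19822e1`,
`19918b1`; every one `#Ш_an = 9`, i.e. a NON-UNIT cell). All twelve are ALREADY PROVED-by-name flag-free (referee A R302,
`X6.bsdp3_sel9_<label>` in `SignedLowerHalvesKobayashiLowerHalfSemistableSelmerNineRecords.lean`, binders
{`hCT`, `hW`, `hGZK`, `hmod`} + `hSel : Sel^(3)(E/ℚ) ≠ ⊥`). THIS FILE books nothing new and moves no count: it is the
seat's strategy sentence («explicit p-descent certificate road: Sel_p(E/ℚ) exactly … + Kato's upper bound ⇒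
#Ш[p^∞] = p^{ord_p Ш_an} on the non-unit cells») DISPLAYED on the cells of record, as CT-FREE TWINS: the same three
published facts MINUS the Cassels–Tate pairing, and the certificate read EXACTLY (`#Sel^(3)(E/ℚ) = 9`, i.e.
`dim_𝔽₃ Sel^(3) = 2` — which is what both engines of `Supersingular/X678DescentRecords.lean`
`checked_x6_rankZero_sha9_desc3` return in EXACT mode, kit j091546) instead of `≠ ⊥`. Consumer:
`PrintX6.X6.bsdp_rankZero_of_card_selmerGroup` (`Theorems/PrintX6DescentCertificateRoad.lean`): `Sel^(3) ≅ Ш[3]`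
(Silverman X.4.2; rank `0` by GZK, `E(ℚ)[3] = 0` by `ClassX6.irr`) so `9 ∣ #Ш`, and Wuthrich's Prop. 21 gives
`ord₃ #Ш ≤ 2`. BEYOND-PRINT THEOREM: **NO**. Per pair; NOT a class theorem; the class-wide residual on A6 is the
lower half `MissingLowerBoundAt` = crux `KobayashiLowerHalfSemistable` (stmt-BirchSwinnertonDyer-19000).

Shape. §1: the twelve twins in the LIGHT shape of k3-c2's class lemmas `classX6_c<label>_3` (instances
`[W.IsElliptic] [W.IsGloballyMinimal]` displayed, model pinned by `hWeq`); §2: the fully DECIDED shape (Δ ≠ 0 and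
bounded Kraus minimality evaluated in the kernel, the terms of `X6.bsdp3_sel9_2534e1` verbatim) for `2534e1`, showing
the decided form is one `exact` on top of §1. Displayed per pair: `hW`, `hGZK`, `hmod`; `hr` (`r_an = 0`, Cremona);
`hq`/`hv` (`#Ш_an = q`, `ord₃ q ≤ 2`); `hcard : #Sel^(3)(E/ℚ) = 9` (EVIDENCE = the landed two-engine row, cert
sha256 prefix quoted per docstring).

References: [Wuthrich2014] Prop. 21; [SilvermanAEC2009] Thm. X.4.2 (a), VII.1 Rem. 1.1; [Serre1972] §1.11 Prop. 12,
§5.4 Prop. 21 i); [Miller2011LMS] Def. 1.1; [Cremona2006] Table 1; Schaefer–Stoll 2004 [SchaeferStoll2004].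
-/

set_option autoImplicit false
set_option linter.dupNamespace false

noncomputable section

open scoped Classical

open WeierstrassCurve Literature.NumberTheory.EllipticCurves
  Literature.NumberTheory.EllipticCurves.Rank1Residual
  Literature.NumberTheory.EllipticCurves.Rank1Residual.Typed
  Literature.NumberTheory.EllipticCurves.Rank1Residual.X11RankOneCertificates
  Literature.NumberTheory.EllipticCurves.Wuthrich2014
  Summit.BirchSwinnertonDyer.BirchSwinnertonDyer.Rank1Residual.X11RankOne
  Summit.BirchSwinnertonDyer.Rank1Residual.X11b

namespace Summit.BirchSwinnertonDyer.BirchSwinnertonDyer.Theorems.PrintX6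

/-! ### §1 The twelve CT-free twins (light shape) -/

/-- **`BSD(E,3)` for `2534e1`, CT-free** — A6 @ 3 non-unit cell (X6 ∩ {r_an = 0}, `#Ш_an = 9`); Cremona model
`[1,-1,1,-1393324,-640018129]`, `N = 2534 = 2·7·181`, `#E(ℚ)_tors = 4`. `ClassX6 W 3` = k3-c2's `classX6_c2534e1_3`. Binders: PUBLISHED
`hW` (Wuthrich Prop. 21), `hGZK`, `hmod` — NO `hCT`; per pair `hr`, `hq`/`hv`, and the EXACT certificate
`hcard : #Sel^(3)(E/ℚ) = 9` — EVIDENCE: row `2534e1` of `checked_x6_rankZero_sha9_desc3` (`dim_𝔽₃ Sel^(3) = 2` on both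
engines, EXACT, same subspace; cert `dca2e1f44343…`; kit j091546). Twin of `X6.bsdp3_sel9_2534e1`. Per pair; books nothing new.
[cite: Wuthrich2014, Prop. 21 (p. 400)] [cite: SilvermanAEC2009, Thm X.4.2(a)] [cite: Cremona2006, Table 1 (Cremona label 2534e1)] -/
theorem X6.bsdp3_sel9exact_2534e1 (hW : sha_dvd_analyticSha)
    (hGZK : rank_eq_analyticRank_of_analyticRank_le_one) (hmod : hasEntireLFunction_rat)
    {W : WeierstrassCurve ℚ} [W.IsElliptic] [W.IsGloballyMinimal] (hWeq : W = ⟨1, -1, 1, -1393324, -640018129⟩)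
    (hr : W.analyticRank = 0) {q : ℚ} (hq : shaAn W = (q : ℂ)) (hv : padicValRat 3 q ≤ 2)
    (hcard : Nat.card (W.selmerGroup (3 : ℤ)) = 9) : BSDp W 3 :=
  haveI : Fact (Nat.Prime 3) := ⟨by norm_num⟩
  X6.bsdp_rankZero_of_card_selmerGroup W 3 hW hGZK hmod (by norm_num) (classX6_c2534e1_3 hWeq) hr
    (m := 2) (by rw [show (3 : ℕ) ^ 2 = 9 from rfl]; exact_mod_cast hcard) hq hv

/-- **`BSD(E,3)` for `4343b1`, CT-free** — A6 @ 3 non-unit cell (X6 ∩ {r_an = 0}, `#Ш_an = 9`); Cremona model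
`[0,0,1,-325259,-71398995]`, `N = 4343 = 43·101`, `#E(ℚ)_tors = 1`. `ClassX6 W 3` = k3-c2's `classX6_c4343b1_3`. Binders: PUBLISHED
`hW` (Wuthrich Prop. 21), `hGZK`, `hmod` — NO `hCT`; per pair `hr`, `hq`/`hv`, and the EXACT certificate
`hcard : #Sel^(3)(E/ℚ) = 9` — EVIDENCE: row `4343b1` of `checked_x6_rankZero_sha9_desc3` (`dim_𝔽₃ Sel^(3) = 2` on both
engines, EXACT, same subspace; cert `81b889fd2b7c…`; kit j091546). Twin of `X6.bsdp3_sel9_4343b1`. Per pair; books nothing new.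
[cite: Wuthrich2014, Prop. 21 (p. 400)] [cite: SilvermanAEC2009, Thm X.4.2(a)] [cite: Cremona2006, Table 1 (Cremona label 4343b1)] -/
theorem X6.bsdp3_sel9exact_4343b1 (hW : sha_dvd_analyticSha)
    (hGZK : rank_eq_analyticRank_of_analyticRank_le_one) (hmod : hasEntireLFunction_rat)
    {W : WeierstrassCurve ℚ} [W.IsElliptic] [W.IsGloballyMinimal] (hWeq : W = ⟨0, 0, 1, -325259, -71398995⟩)
    (hr : W.analyticRank = 0) {q : ℚ} (hq : shaAn W = (q : ℂ)) (hv : padicValRat 3 q ≤ 2)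
    (hcard : Nat.card (W.selmerGroup (3 : ℤ)) = 9) : BSDp W 3 :=
  haveI : Fact (Nat.Prime 3) := ⟨by norm_num⟩
  X6.bsdp_rankZero_of_card_selmerGroup W 3 hW hGZK hmod (by norm_num) (classX6_c4343b1_3 hWeq) hr
    (m := 2) (by rw [show (3 : ℕ) ^ 2 = 9 from rfl]; exact_mod_cast hcard) hq hv

/-- **`BSD(E,3)` for `4963c1`, CT-free** — A6 @ 3 non-unit cell (X6 ∩ {r_an = 0}, `#Ш_an = 9`); Cremona model
`[1,-1,0,-236,-1341]`, `N = 4963 = 7·709`, `#E(ℚ)_tors = 2`. `ClassX6 W 3` = k3-c2's `classX6_c4963c1_3`. Binders: PUBLISHED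
`hW` (Wuthrich Prop. 21), `hGZK`, `hmod` — NO `hCT`; per pair `hr`, `hq`/`hv`, and the EXACT certificate
`hcard : #Sel^(3)(E/ℚ) = 9` — EVIDENCE: row `4963c1` of `checked_x6_rankZero_sha9_desc3` (`dim_𝔽₃ Sel^(3) = 2` on both
engines, EXACT, same subspace; cert `60884746de87…`; kit j091546). Twin of `X6.bsdp3_sel9_4963c1`. Per pair; books nothing new.
[cite: Wuthrich2014, Prop. 21 (p. 400)] [cite: SilvermanAEC2009, Thm X.4.2(a)] [cite: Cremona2006, Table 1 (Cremona label 4963c1)] -/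
theorem X6.bsdp3_sel9exact_4963c1 (hW : sha_dvd_analyticSha)
    (hGZK : rank_eq_analyticRank_of_analyticRank_le_one) (hmod : hasEntireLFunction_rat)
    {W : WeierstrassCurve ℚ} [W.IsElliptic] [W.IsGloballyMinimal] (hWeq : W = ⟨1, -1, 0, -236, -1341⟩)
    (hr : W.analyticRank = 0) {q : ℚ} (hq : shaAn W = (q : ℂ)) (hv : padicValRat 3 q ≤ 2)
    (hcard : Nat.card (W.selmerGroup (3 : ℤ)) = 9) : BSDp W 3 :=
  haveI : Fact (Nat.Prime 3) := ⟨by norm_num⟩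
  X6.bsdp_rankZero_of_card_selmerGroup W 3 hW hGZK hmod (by norm_num) (classX6_c4963c1_3 hWeq) hr
    (m := 2) (by rw [show (3 : ℕ) ^ 2 = 9 from rfl]; exact_mod_cast hcard) hq hv

/-- **`BSD(E,3)` for `5561a1`, CT-free** — A6 @ 3 non-unit cell (X6 ∩ {r_an = 0}, `#Ш_an = 9`); Cremona model
`[1,-1,0,-121,-408]`, `N = 5561 = 67·83`, `#E(ℚ)_tors = 4`. `ClassX6 W 3` = k3-c2's `classX6_c5561a1_3`. Binders: PUBLISHED
`hW` (Wuthrich Prop. 21), `hGZK`, `hmod` — NO `hCT`; per pair `hr`, `hq`/`hv`, and the EXACT certificate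
`hcard : #Sel^(3)(E/ℚ) = 9` — EVIDENCE: row `5561a1` of `checked_x6_rankZero_sha9_desc3` (`dim_𝔽₃ Sel^(3) = 2` on both
engines, EXACT, same subspace; cert `a8fa89d7fd79…`; kit j091546). Twin of `X6.bsdp3_sel9_5561a1`. Per pair; books nothing new.
[cite: Wuthrich2014, Prop. 21 (p. 400)] [cite: SilvermanAEC2009, Thm X.4.2(a)] [cite: Cremona2006, Table 1 (Cremona label 5561a1)] -/
theorem X6.bsdp3_sel9exact_5561a1 (hW : sha_dvd_analyticSha)
    (hGZK : rank_eq_analyticRank_of_analyticRank_le_one) (hmod : hasEntireLFunction_rat)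
    {W : WeierstrassCurve ℚ} [W.IsElliptic] [W.IsGloballyMinimal] (hWeq : W = ⟨1, -1, 0, -121, -408⟩)
    (hr : W.analyticRank = 0) {q : ℚ} (hq : shaAn W = (q : ℂ)) (hv : padicValRat 3 q ≤ 2)
    (hcard : Nat.card (W.selmerGroup (3 : ℤ)) = 9) : BSDp W 3 :=
  haveI : Fact (Nat.Prime 3) := ⟨by norm_num⟩
  X6.bsdp_rankZero_of_card_selmerGroup W 3 hW hGZK hmod (by norm_num) (classX6_c5561a1_3 hWeq) hr
    (m := 2) (by rw [show (3 : ℕ) ^ 2 = 9 from rfl]; exact_mod_cast hcard) hq hv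

/-- **`BSD(E,3)` for `8710b1`, CT-free** — A6 @ 3 non-unit cell (X6 ∩ {r_an = 0}, `#Ш_an = 9`); Cremona model
`[1,-1,0,-76040,-12298944]`, `N = 8710 = 2·5·13·67`, `#E(ℚ)_tors = 2`. `ClassX6 W 3` = k3-c2's `classX6_c8710b1_3`. Binders: PUBLISHED
`hW` (Wuthrich Prop. 21), `hGZK`, `hmod` — NO `hCT`; per pair `hr`, `hq`/`hv`, and the EXACT certificate
`hcard : #Sel^(3)(E/ℚ) = 9` — EVIDENCE: row `8710b1` of `checked_x6_rankZero_sha9_desc3` (`dim_𝔽₃ Sel^(3) = 2` on both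
engines, EXACT, same subspace; cert `26e418a6fb81…`; kit j091546). Twin of `X6.bsdp3_sel9_8710b1`. Per pair; books nothing new.
[cite: Wuthrich2014, Prop. 21 (p. 400)] [cite: SilvermanAEC2009, Thm X.4.2(a)] [cite: Cremona2006, Table 1 (Cremona label 8710b1)] -/
theorem X6.bsdp3_sel9exact_8710b1 (hW : sha_dvd_analyticSha)
    (hGZK : rank_eq_analyticRank_of_analyticRank_le_one) (hmod : hasEntireLFunction_rat)
    {W : WeierstrassCurve ℚ} [W.IsElliptic] [W.IsGloballyMinimal] (hWeq : W = ⟨1, -1, 0, -76040, -12298944⟩)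
    (hr : W.analyticRank = 0) {q : ℚ} (hq : shaAn W = (q : ℂ)) (hv : padicValRat 3 q ≤ 2)
    (hcard : Nat.card (W.selmerGroup (3 : ℤ)) = 9) : BSDp W 3 :=
  haveI : Fact (Nat.Prime 3) := ⟨by norm_num⟩
  X6.bsdp_rankZero_of_card_selmerGroup W 3 hW hGZK hmod (by norm_num) (classX6_c8710b1_3 hWeq) hr
    (m := 2) (by rw [show (3 : ℕ) ^ 2 = 9 from rfl]; exact_mod_cast hcard) hq hv

/-- **`BSD(E,3)` for `12034a1`, CT-free** — A6 @ 3 non-unit cell (X6 ∩ {r_an = 0}, `#Ш_an = 9`); Cremona model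
`[1,-1,0,-56738,-5228652]`, `N = 12034 = 2·11·547`, `#E(ℚ)_tors = 1`. `ClassX6 W 3` = k3-c2's `classX6_c12034a1_3`. Binders: PUBLISHED
`hW` (Wuthrich Prop. 21), `hGZK`, `hmod` — NO `hCT`; per pair `hr`, `hq`/`hv`, and the EXACT certificate
`hcard : #Sel^(3)(E/ℚ) = 9` — EVIDENCE: row `12034a1` of `checked_x6_rankZero_sha9_desc3` (`dim_𝔽₃ Sel^(3) = 2` on both
engines, EXACT, same subspace; cert `68d43755f64a…`; kit j091546). Twin of `X6.bsdp3_sel9_12034a1`. Per pair; books nothing new.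
[cite: Wuthrich2014, Prop. 21 (p. 400)] [cite: SilvermanAEC2009, Thm X.4.2(a)] [cite: Cremona2006, Table 1 (Cremona label 12034a1)] -/
theorem X6.bsdp3_sel9exact_12034a1 (hW : sha_dvd_analyticSha)
    (hGZK : rank_eq_analyticRank_of_analyticRank_le_one) (hmod : hasEntireLFunction_rat)
    {W : WeierstrassCurve ℚ} [W.IsElliptic] [W.IsGloballyMinimal] (hWeq : W = ⟨1, -1, 0, -56738, -5228652⟩)
    (hr : W.analyticRank = 0) {q : ℚ} (hq : shaAn W = (q : ℂ)) (hv : padicValRat 3 q ≤ 2)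
    (hcard : Nat.card (W.selmerGroup (3 : ℤ)) = 9) : BSDp W 3 :=
  haveI : Fact (Nat.Prime 3) := ⟨by norm_num⟩
  X6.bsdp_rankZero_of_card_selmerGroup W 3 hW hGZK hmod (by norm_num) (classX6_c12034a1_3 hWeq) hr
    (m := 2) (by rw [show (3 : ℕ) ^ 2 = 9 from rfl]; exact_mod_cast hcard) hq hv

/-- **`BSD(E,3)` for `15755a1`, CT-free** — A6 @ 3 non-unit cell (X6 ∩ {r_an = 0}, `#Ш_an = 9`); Cremona model
`[0,0,1,-376928,-139608542]`, `N = 15755 = 5·23·137`, `#E(ℚ)_tors = 1`. `ClassX6 W 3` = k3-c2's `classX6_c15755a1_3`. Binders: PUBLISHED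
`hW` (Wuthrich Prop. 21), `hGZK`, `hmod` — NO `hCT`; per pair `hr`, `hq`/`hv`, and the EXACT certificate
`hcard : #Sel^(3)(E/ℚ) = 9` — EVIDENCE: row `15755a1` of `checked_x6_rankZero_sha9_desc3` (`dim_𝔽₃ Sel^(3) = 2` on both
engines, EXACT, same subspace; cert `92179f69fcf0…`; kit j091546). Twin of `X6.bsdp3_sel9_15755a1`. Per pair; books nothing new.
[cite: Wuthrich2014, Prop. 21 (p. 400)] [cite: SilvermanAEC2009, Thm X.4.2(a)] [cite: Cremona2006, Table 1 (Cremona label 15755a1)] -/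
theorem X6.bsdp3_sel9exact_15755a1 (hW : sha_dvd_analyticSha)
    (hGZK : rank_eq_analyticRank_of_analyticRank_le_one) (hmod : hasEntireLFunction_rat)
    {W : WeierstrassCurve ℚ} [W.IsElliptic] [W.IsGloballyMinimal] (hWeq : W = ⟨0, 0, 1, -376928, -139608542⟩)
    (hr : W.analyticRank = 0) {q : ℚ} (hq : shaAn W = (q : ℂ)) (hv : padicValRat 3 q ≤ 2)
    (hcard : Nat.card (W.selmerGroup (3 : ℤ)) = 9) : BSDp W 3 :=
  haveI : Fact (Nat.Prime 3) := ⟨by norm_num⟩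
  X6.bsdp_rankZero_of_card_selmerGroup W 3 hW hGZK hmod (by norm_num) (classX6_c15755a1_3 hWeq) hr
    (m := 2) (by rw [show (3 : ℕ) ^ 2 = 9 from rfl]; exact_mod_cast hcard) hq hv

/-- **`BSD(E,3)` for `16982a1`, CT-free** — A6 @ 3 non-unit cell (X6 ∩ {r_an = 0}, `#Ш_an = 9`); Cremona model
`[1,-1,0,-25877,-1595787]`, `N = 16982 = 2·7·1213`, `#E(ℚ)_tors = 2`. `ClassX6 W 3` = k3-c2's `classX6_c16982a1_3`. Binders: PUBLISHED
`hW` (Wuthrich Prop. 21), `hGZK`, `hmod` — NO `hCT`; per pair `hr`, `hq`/`hv`, and the EXACT certificate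
`hcard : #Sel^(3)(E/ℚ) = 9` — EVIDENCE: row `16982a1` of `checked_x6_rankZero_sha9_desc3` (`dim_𝔽₃ Sel^(3) = 2` on both
engines, EXACT, same subspace; cert `2ead8ed37e15…`; kit j091546). Twin of `X6.bsdp3_sel9_16982a1`. Per pair; books nothing new.
[cite: Wuthrich2014, Prop. 21 (p. 400)] [cite: SilvermanAEC2009, Thm X.4.2(a)] [cite: Cremona2006, Table 1 (Cremona label 16982a1)] -/
theorem X6.bsdp3_sel9exact_16982a1 (hW : sha_dvd_analyticSha)
    (hGZK : rank_eq_analyticRank_of_analyticRank_le_one) (hmod : hasEntireLFunction_rat)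
    {W : WeierstrassCurve ℚ} [W.IsElliptic] [W.IsGloballyMinimal] (hWeq : W = ⟨1, -1, 0, -25877, -1595787⟩)
    (hr : W.analyticRank = 0) {q : ℚ} (hq : shaAn W = (q : ℂ)) (hv : padicValRat 3 q ≤ 2)
    (hcard : Nat.card (W.selmerGroup (3 : ℤ)) = 9) : BSDp W 3 :=
  haveI : Fact (Nat.Prime 3) := ⟨by norm_num⟩
  X6.bsdp_rankZero_of_card_selmerGroup W 3 hW hGZK hmod (by norm_num) (classX6_c16982a1_3 hWeq) hr
    (m := 2) (by rw [show (3 : ℕ) ^ 2 = 9 from rfl]; exact_mod_cast hcard) hq hv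

/-- **`BSD(E,3)` for `17917b1`, CT-free** — A6 @ 3 non-unit cell (X6 ∩ {r_an = 0}, `#Ш_an = 9`); Cremona model
`[0,0,1,-6671,-209767]`, `N = 17917 = 19·23·41`, `#E(ℚ)_tors = 1`. `ClassX6 W 3` = k3-c2's `classX6_c17917b1_3`. Binders: PUBLISHED
`hW` (Wuthrich Prop. 21), `hGZK`, `hmod` — NO `hCT`; per pair `hr`, `hq`/`hv`, and the EXACT certificate
`hcard : #Sel^(3)(E/ℚ) = 9` — EVIDENCE: row `17917b1` of `checked_x6_rankZero_sha9_desc3` (`dim_𝔽₃ Sel^(3) = 2` on both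
engines, EXACT, same subspace; cert `81b1a834e563…`; kit j091546). Twin of `X6.bsdp3_sel9_17917b1`. Per pair; books nothing new.
[cite: Wuthrich2014, Prop. 21 (p. 400)] [cite: SilvermanAEC2009, Thm X.4.2(a)] [cite: Cremona2006, Table 1 (Cremona label 17917b1)] -/
theorem X6.bsdp3_sel9exact_17917b1 (hW : sha_dvd_analyticSha)
    (hGZK : rank_eq_analyticRank_of_analyticRank_le_one) (hmod : hasEntireLFunction_rat)
    {W : WeierstrassCurve ℚ} [W.IsElliptic] [W.IsGloballyMinimal] (hWeq : W = ⟨0, 0, 1, -6671, -209767⟩)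
    (hr : W.analyticRank = 0) {q : ℚ} (hq : shaAn W = (q : ℂ)) (hv : padicValRat 3 q ≤ 2)
    (hcard : Nat.card (W.selmerGroup (3 : ℤ)) = 9) : BSDp W 3 :=
  haveI : Fact (Nat.Prime 3) := ⟨by norm_num⟩
  X6.bsdp_rankZero_of_card_selmerGroup W 3 hW hGZK hmod (by norm_num) (classX6_c17917b1_3 hWeq) hr
    (m := 2) (by rw [show (3 : ℕ) ^ 2 = 9 from rfl]; exact_mod_cast hcard) hq hv

/-- **`BSD(E,3)` for `19142a1`, CT-free** — A6 @ 3 non-unit cell (X6 ∩ {r_an = 0}, `#Ш_an = 9`); Cremona model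
`[1,-1,0,-5125,-139947]`, `N = 19142 = 2·17·563`, `#E(ℚ)_tors = 1`. `ClassX6 W 3` = k3-c2's `classX6_c19142a1_3`. Binders: PUBLISHED
`hW` (Wuthrich Prop. 21), `hGZK`, `hmod` — NO `hCT`; per pair `hr`, `hq`/`hv`, and the EXACT certificate
`hcard : #Sel^(3)(E/ℚ) = 9` — EVIDENCE: row `19142a1` of `checked_x6_rankZero_sha9_desc3` (`dim_𝔽₃ Sel^(3) = 2` on both
engines, EXACT, same subspace; cert `657a4e2b3b05…`; kit j091546). Twin of `X6.bsdp3_sel9_19142a1`. Per pair; books nothing new.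
[cite: Wuthrich2014, Prop. 21 (p. 400)] [cite: SilvermanAEC2009, Thm X.4.2(a)] [cite: Cremona2006, Table 1 (Cremona label 19142a1)] -/
theorem X6.bsdp3_sel9exact_19142a1 (hW : sha_dvd_analyticSha)
    (hGZK : rank_eq_analyticRank_of_analyticRank_le_one) (hmod : hasEntireLFunction_rat)
    {W : WeierstrassCurve ℚ} [W.IsElliptic] [W.IsGloballyMinimal] (hWeq : W = ⟨1, -1, 0, -5125, -139947⟩)
    (hr : W.analyticRank = 0) {q : ℚ} (hq : shaAn W = (q : ℂ)) (hv : padicValRat 3 q ≤ 2)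
    (hcard : Nat.card (W.selmerGroup (3 : ℤ)) = 9) : BSDp W 3 :=
  haveI : Fact (Nat.Prime 3) := ⟨by norm_num⟩
  X6.bsdp_rankZero_of_card_selmerGroup W 3 hW hGZK hmod (by norm_num) (classX6_c19142a1_3 hWeq) hr
    (m := 2) (by rw [show (3 : ℕ) ^ 2 = 9 from rfl]; exact_mod_cast hcard) hq hv

/-- **`BSD(E,3)` for `19822e1`, CT-free** — A6 @ 3 non-unit cell (X6 ∩ {r_an = 0}, `#Ш_an = 9`); Cremona model
`[1,-1,1,-15349,-728069]`, `N = 19822 = 2·11·17·53`, `#E(ℚ)_tors = 1`. `ClassX6 W 3` = k3-c2's `classX6_c19822e1_3`. Binders: PUBLISHED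
`hW` (Wuthrich Prop. 21), `hGZK`, `hmod` — NO `hCT`; per pair `hr`, `hq`/`hv`, and the EXACT certificate
`hcard : #Sel^(3)(E/ℚ) = 9` — EVIDENCE: row `19822e1` of `checked_x6_rankZero_sha9_desc3` (`dim_𝔽₃ Sel^(3) = 2` on both
engines, EXACT, same subspace; cert `f912d65b704e…`; kit j091546). Twin of `X6.bsdp3_sel9_19822e1`. Per pair; books nothing new.
[cite: Wuthrich2014, Prop. 21 (p. 400)] [cite: SilvermanAEC2009, Thm X.4.2(a)] [cite: Cremona2006, Table 1 (Cremona label 19822e1)] -/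
theorem X6.bsdp3_sel9exact_19822e1 (hW : sha_dvd_analyticSha)
    (hGZK : rank_eq_analyticRank_of_analyticRank_le_one) (hmod : hasEntireLFunction_rat)
    {W : WeierstrassCurve ℚ} [W.IsElliptic] [W.IsGloballyMinimal] (hWeq : W = ⟨1, -1, 1, -15349, -728069⟩)
    (hr : W.analyticRank = 0) {q : ℚ} (hq : shaAn W = (q : ℂ)) (hv : padicValRat 3 q ≤ 2)
    (hcard : Nat.card (W.selmerGroup (3 : ℤ)) = 9) : BSDp W 3 :=
  haveI : Fact (Nat.Prime 3) := ⟨by norm_num⟩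
  X6.bsdp_rankZero_of_card_selmerGroup W 3 hW hGZK hmod (by norm_num) (classX6_c19822e1_3 hWeq) hr
    (m := 2) (by rw [show (3 : ℕ) ^ 2 = 9 from rfl]; exact_mod_cast hcard) hq hv

/-- **`BSD(E,3)` for `19918b1`, CT-free** — A6 @ 3 non-unit cell (X6 ∩ {r_an = 0}, `#Ш_an = 9`); Cremona model
`[1,-1,0,46148,12515664]`, `N = 19918 = 2·23·433`, `#E(ℚ)_tors = 2`. `ClassX6 W 3` = k3-c2's `classX6_c19918b1_3`. Binders: PUBLISHED
`hW` (Wuthrich Prop. 21), `hGZK`, `hmod` — NO `hCT`; per pair `hr`, `hq`/`hv`, and the EXACT certificate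
`hcard : #Sel^(3)(E/ℚ) = 9` — EVIDENCE: row `19918b1` of `checked_x6_rankZero_sha9_desc3` (`dim_𝔽₃ Sel^(3) = 2` on both
engines, EXACT, same subspace; cert `97ba2e3c695d…`; kit j091546). Twin of `X6.bsdp3_sel9_19918b1`. Per pair; books nothing new.
[cite: Wuthrich2014, Prop. 21 (p. 400)] [cite: SilvermanAEC2009, Thm X.4.2(a)] [cite: Cremona2006, Table 1 (Cremona label 19918b1)] -/
theorem X6.bsdp3_sel9exact_19918b1 (hW : sha_dvd_analyticSha)
    (hGZK : rank_eq_analyticRank_of_analyticRank_le_one) (hmod : hasEntireLFunction_rat)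
    {W : WeierstrassCurve ℚ} [W.IsElliptic] [W.IsGloballyMinimal] (hWeq : W = ⟨1, -1, 0, 46148, 12515664⟩)
    (hr : W.analyticRank = 0) {q : ℚ} (hq : shaAn W = (q : ℂ)) (hv : padicValRat 3 q ≤ 2)
    (hcard : Nat.card (W.selmerGroup (3 : ℤ)) = 9) : BSDp W 3 :=
  haveI : Fact (Nat.Prime 3) := ⟨by norm_num⟩
  X6.bsdp_rankZero_of_card_selmerGroup W 3 hW hGZK hmod (by norm_num) (classX6_c19918b1_3 hWeq) hr
    (m := 2) (by rw [show (3 : ℕ) ^ 2 = 9 from rfl]; exact_mod_cast hcard) hq hv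

/-! ### §2 The decided shape (instances evaluated in the kernel) for `2534e1` -/

/-- **`BSD(E,3)` for `2534e1`, CT-free, DECIDED shape**: as `X6.bsdp3_sel9exact_2534e1` with `Δ ≠ 0`
(`isElliptic_of_discOf_ne_zero`) and global minimality (bounded Kraus criterion, the three `decide` terms of
`X6.bsdp3_sel9_2534e1` verbatim) evaluated in the kernel, so that only the three PUBLISHED facts, `hr`, `hq`/`hv` and the
certificate `hcard` remain displayed. [cite: Wuthrich2014, Prop. 21 (p. 400)] [cite: SilvermanAEC2009, Thm X.4.2(a) and VII.1 Remark 1.1]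
[cite: Cremona2006, Table 1 (Cremona label 2534e1)] -/
theorem X6.bsdp3_sel9exact_2534e1_decided (hW : sha_dvd_analyticSha)
    (hGZK : rank_eq_analyticRank_of_analyticRank_le_one) (hmod : hasEntireLFunction_rat)
    (W : WeierstrassCurve ℚ) (hWm : W = ⟨1, -1, 1, -1393324, -640018129⟩) (hr : W.analyticRank = 0)
    {q : ℚ} (hq : shaAn W = (q : ℂ)) (hv : padicValRat 3 q ≤ 2)
    (hcard : Nat.card (W.selmerGroup (3 : ℤ)) = 9) : BSDp W 3 := by
  subst hWm
  haveI : (⟨1, -1, 1, -1393324, -640018129⟩ : WeierstrassCurve ℚ).IsElliptic :=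
    isElliptic_of_discOf_ne_zero 1 (-1) 1 (-1393324) (-640018129) (by decide)
  haveI : (⟨1, -1, 1, -1393324, -640018129⟩ : WeierstrassCurve ℚ).IsGloballyMinimal :=
    isGloballyMinimal_of_krausCriterion_bounded 1 (-1) 1 (-1393324) (-640018129)
      (by decide +kernel) (by decide +kernel) (by decide +kernel)
  exact X6.bsdp3_sel9exact_2534e1 hW hGZK hmod rfl hr hq hv hcard

end Summit.BirchSwinnertonDyer.BirchSwinnertonDyer.Theorems.PrintX6

end
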